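import Mathlib
import Summits.Schanuel.Schanuel.Theorems.RigidCoreMinimalCounterexampleInAclCorankGeTwoNoFullLineCurveCase

/-!
# S7b FROM COSET-LINE SPARSITY — crux stmt-Schanuel-0969 `RigidCore.MinimalCounterexampleInAcl`

Line `kernel-arithmetic-selection` (lead prover-line-stmt-Schanuel-0969-c16-0), registered stub
`stub_noFullLine_of_cosetLineSparsity` (R3, glue; `--supports stmt-Schanuel-0969`): the formal reduction of S7b (no full line of
mates in a log direction at corank `≥ 2`) to the two research statements of gen 31,

* FCS♭ (first antecedent) — COSET-LINE SPARSITY IN DIMENSION-DROP FORM: a fibre-finite coset family `q : ℤ → ℂ^ι` of ℚ-linearly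
  independent points over `c + 2πiℤ` in the coordinate `i₀` has upper Banach density zero as soon as, along every sub-family `J'`
  of positive upper Banach density and for every lattice `Λ` of directions constant along `J'`, some Zariski closed `W` contains
  the points `(q_j, e^{q_j})`, `j ∈ J'`, with `dim W + rank Λ < #ι`;
* R2 (second antecedent) — THE FIRST-FAILURE DIMENSION DROP: for a family of mates of a first failure of rank `n` taking at least
  two values and a lattice `Λ` of directions constant along it, such a `W` with `dim W + rank Λ < n` exists.

PROOF.  Suppose every kernel translate `(x_i + 2πijμ_i)_{i<r}`, `j ∈ ℤ`, is the log part of a mate `xm_j` of `x`.  Pick `μ_{k₀} = d ≠ 0`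
(so `k₀ < r`); then `xm_j k₀ = x_{k₀} + 2πijd`, so `j ↦ xm_j` is injective, and the reindexed family `q_m = xm_{m/d}` over `J = dℤ` is
a coset family in the coordinate `k₀` (`q_m k₀ = x_{k₀} + 2πim`), ℚ-linearly independent (mates), fibre-finite (mates with prescribed
exponentials are finitely many, `locusMates_cexp_fibre_finite`).  Along a positive-density `J'' ⊆ dℤ` the index set `J' = J''/d` is
infinite (`infinite_of_upperDensity_pos`), so the injective family takes two values there and R2 supplies the dimension drop.  FCS♭
then says `dℤ` has upper Banach density zero — but the window `[0, K|d|)` contains the `K` multiples `t|d|`, `t < K`, of `d`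
(`le_ncard_multiples_window`), so `dℤ` has density `1/|d| > 0` (`not_densityZero_multiples`).

References: status note `Cruxes/MinimalCounterexampleInAcl/Lines/kernel_arithmetic_selection.md` §Addendum c16; obstruction note
`Cruxes/MinimalCounterexampleInAcl/Lines/kernel_arithmetic_selection_S7b_obstruction.md` §5(iii).
-/

noncomputable section

set_option linter.dupNamespace false

open Complex Set

namespace Summit.Schanuel.Schanuel.Cruxes.MinimalCounterexampleInAcl.KernelArithmeticSelection

open Literature.NumberTheory.Transcendental

/-! ## The multiples of `d ≠ 0` have positive upper Banach density -/

/-- **The window `[0, K·|d|)` contains at least `K` multiples of `d ≠ 0`**, namely `t·|d|` for `t < K`. [folklore] -/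
theorem le_ncard_multiples_window {d : ℤ} (hd : d ≠ 0) (K : ℕ) :
    K ≤ Set.ncard {j : ℤ | j ∈ Finset.Ico (0 : ℤ) (0 + ((K * d.natAbs : ℕ) : ℤ)) ∧ j ∈ {m : ℤ | d ∣ m}} := by
  classical
  have hDpos : 0 < d.natAbs := Int.natAbs_pos.2 hd
  have hD0 : (d.natAbs : ℤ) ≠ 0 := by exact_mod_cast hDpos.ne'
  set T : Finset ℤ := (Finset.range K).image (fun t : ℕ => (t : ℤ) * d.natAbs) with hT
  have hTinj : Function.Injective (fun t : ℕ => (t : ℤ) * d.natAbs) := by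
    intro t t' h
    exact_mod_cast mul_right_cancel₀ hD0 h
  have hTcard : T.card = K := by
    rw [hT, Finset.card_image_of_injective _ hTinj, Finset.card_range]
  have hfin : Set.Finite {j : ℤ | j ∈ Finset.Ico (0 : ℤ) (0 + ((K * d.natAbs : ℕ) : ℤ)) ∧ j ∈ {m : ℤ | d ∣ m}} :=
    (Finset.finite_toSet _).subset fun j hj => Finset.mem_coe.2 hj.1
  calc K = (↑T : Set ℤ).ncard := by rw [Set.ncard_coe_finset, hTcard]
    _ ≤ _ := Set.ncard_le_ncard ?_ hfin
  intro m hm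
  obtain ⟨t, ht, rfl⟩ := Finset.mem_image.1 (Finset.mem_coe.1 hm)
  have ht' : t < K := Finset.mem_range.1 ht
  refine ⟨Finset.mem_Ico.2 ⟨by positivity, ?_⟩, ?_⟩
  · rw [zero_add, Nat.cast_mul]
    exact mul_lt_mul_of_pos_right (by exact_mod_cast ht') (by exact_mod_cast hDpos)
  · exact (Int.dvd_natAbs.2 dvd_rfl).mul_left _

/-- **The multiples of `d ≠ 0` do NOT have upper Banach density zero**: the window `[0, (N₀+1)|d|)` has `N₀ + 1` of them, more
than `(N₀+1)/2 = δ·N` for `δ = 1/(2|d|)`. [folklore] -/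
theorem not_densityZero_multiples {d : ℤ} (hd : d ≠ 0) :
    ¬ ∀ δ : ℝ, 0 < δ → ∃ N₀ : ℕ, ∀ N : ℕ, N₀ ≤ N → ∀ a : ℤ,
      (Set.ncard {j : ℤ | j ∈ Finset.Ico a (a + (N : ℤ)) ∧ j ∈ {m : ℤ | d ∣ m}} : ℝ) < δ * (N : ℝ) := by
  intro h
  have hDpos : 0 < d.natAbs := Int.natAbs_pos.2 hd
  have hDpos' : (0 : ℝ) < d.natAbs := by exact_mod_cast hDpos
  have hD0 : (d.natAbs : ℝ) ≠ 0 := hDpos'.ne'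
  obtain ⟨N₀, hN₀⟩ := h (1 / (2 * (d.natAbs : ℝ))) (by positivity)
  have hle : N₀ ≤ (N₀ + 1) * d.natAbs := (Nat.le_succ N₀).trans (Nat.le_mul_of_pos_right _ hDpos)
  have hwin := hN₀ ((N₀ + 1) * d.natAbs) hle 0
  have hK : ((N₀ + 1 : ℕ) : ℝ) ≤
      (Set.ncard {j : ℤ | j ∈ Finset.Ico (0 : ℤ) (0 + (((N₀ + 1) * d.natAbs : ℕ) : ℤ)) ∧ j ∈ {m : ℤ | d ∣ m}} : ℝ) := by
    exact_mod_cast le_ncard_multiples_window hd (N₀ + 1)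
  have hδN : 1 / (2 * (d.natAbs : ℝ)) * (((N₀ + 1) * d.natAbs : ℕ) : ℝ) = ((N₀ + 1 : ℕ) : ℝ) / 2 := by
    push_cast
    field_simp
  rw [hδN] at hwin
  have hpos : (0 : ℝ) < ((N₀ + 1 : ℕ) : ℝ) := by positivity
  linarith

/-! ## The registered stub -/

/-- **Stub R3 — S7b FROM COSET-LINE SPARSITY (glue; PROVED).**  FCS♭ ⟹ R2's conclusion ⟹ S7b: a full line of mates
`j ↦ xm_j` in the log direction `μ` (`μ_{k₀} = d ≠ 0`) is, after reindexing `m = jd`, a coset family over `dℤ` in the coordinate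
`k₀` (`xm_j k₀ = x_{k₀} + 2πijd`), ℚ-linearly independent (mates), fibre-finite (`locusMates_cexp_fibre_finite`), with the dimension
drop along every positive-density sub-family supplied by R2 (the injective family takes two values on the infinite index set);
FCS♭ then gives upper Banach density zero for `dℤ`, which has density `1/|d|` (`not_densityZero_multiples`). [folklore] -/
theorem stub_noFullLine_of_cosetLineSparsity : (∀ (ι : Type) [Fintype ι] (i₀ : ι) (c : ℂ) (J : Set ℤ) (q : ℤ → ι → ℂ), (∀ j ∈ J, LinearIndependent ℚ (q j) ∧ q j i₀ = c + 2 * ↑Real.pi * Complex.I * (j : ℂ)) → (∀ ω : ι → ℂ, Set.Finite {j : ℤ | j ∈ J ∧ Complex.exp ∘ q j = ω}) → (∀ J' ⊆ J, (∃ δ : ℝ, 0 < δ ∧ ∀ N₀ : ℕ, ∃ N : ℕ, N₀ ≤ N ∧ ∃ a : ℤ, δ * (N : ℝ) ≤ (Set.ncard {j : ℤ | j ∈ Finset.Ico a (a + (N : ℤ)) ∧ j ∈ J'} : ℝ)) → ∀ Λ : Submodule ℤ (ι → ℤ), (∀ M ∈ Λ, ∀ j ∈ J', ∀ j' ∈ J',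 (∑ i, (M i : ℂ) * q j i) = ∑ i, (M i : ℂ) * q j' i) → ∃ W : Set (ι ⊕ ι → ℂ), Literature.NumberTheory.Transcendental.IsZariskiClosed ℂ W ∧ Literature.NumberTheory.Transcendental.zariskiDim ℂ W + ((Module.finrank ℤ ↥Λ : ℕ) : WithBot ℕ∞) < ((Fintype.card ι : ℕ) : WithBot ℕ∞) ∧ ∀ j ∈ J', Sum.elim (q j) (Complex.exp ∘ q j) ∈ W) → ∀ δ : ℝ, 0 < δ → ∃ N₀ : ℕ, ∀ N : ℕ, N₀ ≤ N → ∀ a : ℤ, (Set.ncard {j : ℤ | j ∈ Finset.Ico a (a + (N : ℤ)) ∧ j ∈ J} : ℝ) < δ * (N : ℝ)) → (∀ (n : ℕ) (x : Fin n → ℂ), x ∈ Summit.Schanuel.Schanuel.Cruxes.MinimalCounterexampleInAcl.KernelArithmeticSelection.firstFailures n → ∀ (J : Set ℤ) (xm : ℤ → Fin n → ℂ), (∀ j ∈ J, xm j ∈ Summit.Schanuel.Schanuel.Cruxes.MinimalCounterexampleInAcl.KernelArithmeticSelection.locusMates x) → (∃ j ∈ J, ∃ j' ∈ J, xm j ≠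 xm j') → ∀ Λ : Submodule ℤ (Fin n → ℤ), (∀ M ∈ Λ, ∀ j ∈ J, ∀ j' ∈ J, (∑ i, (M i : ℂ) * xm j i) = ∑ i, (M i : ℂ) * xm j' i) → ∃ W : Set (Fin n ⊕ Fin n → ℂ), Literature.NumberTheory.Transcendental.IsZariskiClosed ℂ W ∧ Literature.NumberTheory.Transcendental.zariskiDim ℂ W + ((Module.finrank ℤ ↥Λ : ℕ) : WithBot ℕ∞) < ((n : ℕ) : WithBot ℕ∞) ∧ ∀ j ∈ J, Sum.elim (xm j) (Complex.exp ∘ xm j) ∈ W) → ∀ (n r : ℕ), 3 ≤ n → r + 2 ≤ n → ∀ (x : Fin n → ℂ), x ∈ Summit.Schanuel.Schanuel.Cruxes.MinimalCounterexampleInAcl.KernelArithmeticSelection.firstFailures n → (∀ i : Fin n, (i : ℕ) < r → IsAlgebraic ℚ (Complex.exp (x i))) → (∀ M : Fin n → ℤ, (∃ i : Fin n, r ≤ (i : ℕ) ∧ M i ≠ 0) → Transcendental ℚ (Complex.exp (∑ i, (M i : ℂ) * x i))) → ∀ μ : Fin n → ℤ, (∀ i : Fin n, r ≤ (i : ℕ)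 → μ i = 0) → μ ≠ 0 → ∃ j : ℤ, ¬ ∃ x' ∈ Summit.Schanuel.Schanuel.Cruxes.MinimalCounterexampleInAcl.KernelArithmeticSelection.locusMates x, ∀ i : Fin n, (i : ℕ) < r → x' i = x i + 2 * ↑Real.pi * Complex.I * ((j • μ) i : ℂ) := by
  intro hFlat hVar n r _ _ x hx _ _ μ hμsupp hμ
  classical
  by_contra hall
  push Not at hall
  choose xm hxm hxmeq using hall
  obtain ⟨k₀, hk₀⟩ : ∃ k₀, μ k₀ ≠ 0 := Function.ne_iff.1 hμ
  set d : ℤ := μ k₀ with hd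
  have hd0 : d ≠ 0 := hk₀
  have hk₀r : (k₀ : ℕ) < r := by
    by_contra h
    exact hk₀ (hμsupp k₀ (not_lt.1 h))
  have h2πi : (2 * ↑Real.pi * I : ℂ) ≠ 0 := by simp [Real.pi_ne_zero, I_ne_zero]
  -- ### the moving coordinate of the mates on the line; injectivity
  have hxmk : ∀ j : ℤ, xm j k₀ = x k₀ + 2 * ↑Real.pi * I * ((j * d : ℤ) : ℂ) := by
    intro j
    rw [hxmeq j k₀ hk₀r, Pi.smul_apply, smul_eq_mul]
  have hxminj : Function.Injective xm := by
    intro j j' hjj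
    have h := congrFun hjj k₀
    rw [hxmk, hxmk, add_right_inj] at h
    have h' : ((j * d : ℤ) : ℂ) = ((j' * d : ℤ) : ℂ) := mul_left_cancel₀ h2πi h
    have h'' : j * d = j' * d := by exact_mod_cast h'
    exact mul_right_cancel₀ hd0 h''
  -- ### the reindexed coset family `q_m = xm_{m/d}` over `dℤ`
  set q : ℤ → Fin n → ℂ := fun m => xm (m / d) with hq
  have hqd : ∀ j : ℤ, q (j * d) = xm j := by
    intro j
    simp only [hq, Int.mul_ediv_cancel _ hd0]
  refine not_densityZero_multiples hd0 (hFlat (Fin n) k₀ (x k₀) {m : ℤ | d ∣ m} q ?_ ?_ ?_)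
  · -- ℚ-linearly independent points over the coset `x_{k₀} + 2πiℤ`
    intro m hm
    refine ⟨(hxm (m / d)).1, ?_⟩
    show xm (m / d) k₀ = _
    rw [hxmk, Int.ediv_mul_cancel hm]
  · -- every exponential fibre is met finitely
    intro ω
    refine (((locusMates_cexp_fibre_finite hx ω).preimage hxminj.injOn).image (fun j : ℤ => j * d)).subset ?_
    rintro m ⟨hm, hω⟩
    exact ⟨m / d, ⟨hxm _, hω⟩, Int.ediv_mul_cancel hm⟩
  · -- the dimension drop along positive-density sub-families (R2 on the index set `J''/d`)
    rintro J'' hJ''sub ⟨δ, hδ, hdens⟩ Λ hdead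
    set J' : Set ℤ := {j : ℤ | j * d ∈ J''} with hJ'
    have hmem : ∀ m ∈ J'', m / d ∈ J' ∧ m / d * d = m := by
      intro m hm
      have hdm : d ∣ m := hJ''sub hm
      refine ⟨?_, Int.ediv_mul_cancel hdm⟩
      show m / d * d ∈ J''
      rw [Int.ediv_mul_cancel hdm]
      exact hm
    have hJ''inf : J''.Infinite := infinite_of_upperDensity_pos hδ hdens
    have hJ'inf : J'.Infinite := by
      intro hfin
      refine hJ''inf ((hfin.image (fun j : ℤ => j * d)).subset fun m hm => ?_)
      exact ⟨m / d, (hmem m hm).1, (hmem m hm).2⟩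
    obtain ⟨j₁, hj₁, j₂, hj₂, hne⟩ := hJ'inf.nontrivial
    obtain ⟨W, hWcl, hWdim, hWmem⟩ := hVar n x hx J' xm (fun j _ => hxm j)
      ⟨j₁, hj₁, j₂, hj₂, fun h => hne (hxminj h)⟩ Λ (fun M hM j hj j' hj' => by
        have h := hdead M hM (j * d) hj (j' * d) hj'
        simpa only [hqd] using h)
    refine ⟨W, hWcl, by rwa [Fintype.card_fin], fun m hm => ?_⟩
    exact hWmem (m / d) (hmem m hm).1

end Summit.Schanuel.Schanuel.Cruxes.MinimalCounterexampleInAcl.KernelArithmeticSelection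

end
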